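import Summits.QuantumFields.YangMills.Theorems.BalabanLadderUVSeamRecGaussianCalibrationSharp
import Summits.QuantumFields.YangMills.Theorems.BalabanLadderUVSeamRecGaussianCalibrationLaw
import Mathlib.Analysis.Convex.Integral
import Mathlib.Analysis.Convex.SpecificFunctions.Basic
import HarnessLib

/-!
# Crux `UVSeamRec` (stmt-QuantumFields-20043), free-field calibration of (RM), file 6: the weight `R⁴` of (RM) is CRITICAL — a refuted
# strengthening in the free field

Helper file (`--supports stmt-QuantumFields-20043`) of the seam seat `ym-20043-seam-s2` (gen 3); theorems only, no definitions.

WHY.  The registered v5(α) stub `BirthV5A.stub_responseMomentsOdd6 : UV → (RM)` weighs the centred kernel response by `R⁴/C₁`.  The free-field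
calibration proved (RM) with this weight for the lattice GFF `ν` of `ℤ⁴` (`…Law.gff_responseMoments`) and the two-sided `R⁻⁴` law for the mean response
`c/R⁴ ≤ ∫ Q dν ≤ v/R⁴`, `Q = (∇_j(φ − ψ^Λ)(x))²` (`…Law`, `…Sharp`).  THIS FILE shows that NO FASTER WEIGHT survives even the SINGLETON clause of (RM) in
the free field: for every weight sequence `w(R) → ∞` there are no constants `C₁ > 0`, `B` with
`∫ exp( w(R)·(R⁴/C₁)·|Q − ∫Q dν| ) dν ≤ e^{B}` (together with integrability) for all `R ≥ 1` and all single cubes (`gff_responseMoments_weight_critical`).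
Mechanism: `Q = a²` with `a = ∇_j(φ − ψ^Λ)(x)` a centred GAUSSIAN (boundary linear statistic); for a centred Gaussian `E|a² − Ea²| ≥ (3p₀/4)·E a²` with the
absolute constant `p₀ = P(|g| ≤ ½) > 0` (scaling `gaussianReal_map_const_mul` + `volume ≪ gaussianReal`), `E a² ≥ c/R⁴` (`…Sharp`), and Jensen
`exp(∫Z) ≤ ∫exp Z` gives `w(R)·3p₀c/(4C₁) ≤ B` for all large `R`, impossible.  In (RM) terms: the rate-`R⁻⁴` normalisation of the owner's currency of
record is the only Gaussian-consistent one (rate-`R⁻⁴` RARITY / any `o(R⁻⁴)` typical response is not — the theorem form of ceilings-p2 #54).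

No sorry, standard axioms.  HONEST FRAMING: Gaussian calculus for the massless lattice free field; a TIGHTNESS statement for the calibration of one OPEN
binder of a CONDITIONAL chain; nothing of E0′, not a gap, not Clay.
-/

set_option autoImplicit false

noncomputable section

open MeasureTheory ProbabilityTheory Finset Filter
open Literature.Probability.LatticeModels
open Literature.MathematicalPhysics.QuantumFieldTheory.LatticeForm (e)
open Summit.QuantumFields.YangMills.Theorems.WeakCouplingRates.HarmonicInterior

namespace Summit.QuantumFields.YangMills.Cruxes.UVSeamRec.GaussianCalibration

/-! ## §1 A centred Gaussian square fluctuates by a fixed fraction of its mean -/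

/-- `p₀ = P(|g| ≤ ½) > 0` for a standard Gaussian `g` (Lebesgue measure is absolutely continuous w.r.t. the Gaussian). [folklore] -/
theorem gaussianReal_Icc_half_pos : 0 < (gaussianReal 0 1 (Set.Icc (-(1 / 2 : ℝ)) (1 / 2))).toReal := by
  rw [ENNReal.toReal_pos_iff]
  refine ⟨pos_iff_ne_zero.2 fun h => ?_, measure_lt_top _ _⟩
  have hac := gaussianReal_absolutelyContinuous' (0 : ℝ) (v := 1) one_ne_zero
  have h0 := hac h
  rw [Real.volume_Icc] at h0
  norm_num at h0

/-- **Fluctuation of a Gaussian square**: for a centred real Gaussian `X` (law `gaussianReal 0 σ²`),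
`(3p₀/4)·∫X² ≤ ∫ |X² − ∫X²|`, `p₀ = P(|g| ≤ ½)` — the square of a Gaussian deviates from its mean by a fixed fraction of the mean. [folklore] -/
theorem integral_abs_sq_sub_integral_sq_ge {Ω : Type*} [MeasurableSpace Ω] {P : Measure Ω} {X : Ω → ℝ} (hX : HasGaussianLaw X P)
    (hXm : Measurable X) (h0 : ∫ ω, X ω ∂P = 0) :
    3 / 4 * (gaussianReal 0 1 (Set.Icc (-(1 / 2 : ℝ)) (1 / 2))).toReal * ∫ ω, (X ω) ^ 2 ∂P ≤
      ∫ ω, |(X ω) ^ 2 - ∫ ω', (X ω') ^ 2 ∂P| ∂P := by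
  have hP := hX.isProbabilityMeasure
  set p₀ : ℝ := (gaussianReal 0 1 (Set.Icc (-(1 / 2 : ℝ)) (1 / 2))).toReal with hp₀
  set s : ℝ := ∫ ω, (X ω) ^ 2 ∂P with hs
  have hs0 : 0 ≤ s := integral_nonneg fun ω => sq_nonneg _
  have hX2 : Integrable (fun ω => (X ω) ^ 2) P := hX.memLp_two.integrable_sq
  rcases hs0.eq_or_lt with hs00 | hspos
  · rw [← hs00]; simp only [mul_zero]; exact integral_nonneg fun ω => abs_nonneg _
  -- the law of `X` is `gaussianReal 0 s`
  have hvar : Var[X; P] = s := by rw [variance_of_integral_eq_zero hX.aemeasurable h0]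
  have hlaw : P.map X = gaussianReal 0 s.toNNReal := by
    rw [hX.map_eq_gaussianReal, h0, hvar]
  set σ : ℝ := Real.sqrt s with hσ
  have hσpos : 0 < σ := Real.sqrt_pos.2 hspos
  have hσsq : σ ^ 2 = s := Real.sq_sqrt hs0
  -- `P(|X| ≤ σ/2) = p₀`
  set A : Set Ω := X ⁻¹' Set.Icc (-(σ / 2)) (σ / 2) with hA
  have hAm : MeasurableSet A := hXm measurableSet_Icc
  have hPA : P.real A = p₀ := by
    rw [measureReal_def, hA, ← Measure.map_apply hXm measurableSet_Icc, hlaw, hp₀]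
    congr 1
    have hscale := gaussianReal_map_const_mul (μ := (0 : ℝ)) (v := (1 : NNReal)) σ
    rw [mul_zero, mul_one] at hscale
    have hscale' : (gaussianReal 0 1).map (σ * ·) = gaussianReal 0 s.toNNReal := by
      rw [hscale]
      congr 1
      ext
      simp [hσsq, Real.toNNReal_of_nonneg hs0]
    rw [← hscale', Measure.map_apply (measurable_const_mul σ) measurableSet_Icc]
    congr 1
    ext y
    simp only [Set.mem_preimage, Set.mem_Icc]
    constructor
    · rintro ⟨h1, h2⟩; constructor <;> nlinarith
    · rintro ⟨h1, h2⟩; constructor <;> nlinarith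
  -- pointwise: `|X² − s| ≥ (3s/4)·1_A`
  have hpt : ∀ ω, (3 / 4 * s) * A.indicator (fun _ => (1 : ℝ)) ω ≤ |(X ω) ^ 2 - s| := by
    intro ω
    by_cases hω : ω ∈ A
    · rw [Set.indicator_of_mem hω, mul_one]
      have h1 : (X ω) ^ 2 ≤ s / 4 := by
        have hh : -(σ / 2) ≤ X ω ∧ X ω ≤ σ / 2 := by simpa [hA] using hω
        nlinarith [hh.1, hh.2, hσsq]
      rw [abs_of_nonpos (by linarith)]
      linarith
    · rw [Set.indicator_of_notMem hω, mul_zero]; exact abs_nonneg _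
  have hind : Integrable (fun ω => (3 / 4 * s) * A.indicator (fun _ => (1 : ℝ)) ω) P :=
    ((integrable_const (1 : ℝ)).indicator hAm).const_mul _
  calc 3 / 4 * p₀ * s = ∫ ω, (3 / 4 * s) * A.indicator (fun _ => (1 : ℝ)) ω ∂P := by
        rw [integral_const_mul, integral_indicator_const _ hAm, smul_eq_mul, mul_one, hPA]; ring
    _ ≤ ∫ ω, |(X ω) ^ 2 - s| ∂P := integral_mono hind (hX2.sub (integrable_const s)).abs hpt

/-! ## §2 No faster weight: the refuted strengthening of (RM) in the free field -/

variable {ν : Measure (Site 4 → ℝ)}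

/-- **The weight `R⁴` of (RM) is critical in the free field.**  For the lattice GFF `ν` of `ℤ⁴` and ANY weight sequence `w(R) → ∞` there are no
constants `C₁ > 0`, `B` such that, for all `R ≥ 1`, all directions `j` and centres `x`, the singleton response moment with weight `w(R)·R⁴/C₁`,
`∫ exp( w(R)·(R⁴/C₁)·|Q − ∫Q dν| ) dν`, `Q = (∇_j(φ − ψ^{x+sbox(R+1)})(x))²`, is (finite and) at most `e^{B}` — whereas with weight `R⁴/C₁` the full
family law holds (`…Law.gff_responseMoments`).  Proof: `Q = a²`, `a` a centred Gaussian (boundary linear statistic); `∫|Q − ∫Q| ≥ (3p₀/4)∫Q ≥ (3p₀/4)·c/R⁴`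
(`integral_abs_sq_sub_integral_sq_ge`, `…Sharp.gff_integral_centreGradient_sq_ge`); Jensen `exp(∫Z) ≤ ∫ exp Z`. [folklore] -/
theorem gff_responseMoments_weight_critical (hν : IsDiscreteGFF ν (coordProc 4)) {w : ℕ → ℝ} (hw : Tendsto w atTop atTop) :
    ¬ ∃ C₁ B : ℝ, 0 < C₁ ∧ ∀ (R : ℕ), 1 ≤ R → ∀ (j : Fin 4) (x : Site 4),
      Integrable (fun φ : Site 4 → ℝ => Real.exp (w R * (R : ℝ) ^ 4 / C₁ *
        |((φ (x + e j) - dirichletField ((sbox (R + 1)).image (fun z => x + z)) φ (x + e j)) -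
            (φ x - dirichletField ((sbox (R + 1)).image (fun z => x + z)) φ x)) ^ 2 -
          ∫ φ', ((φ' (x + e j) - dirichletField ((sbox (R + 1)).image (fun z => x + z)) φ' (x + e j)) -
            (φ' x - dirichletField ((sbox (R + 1)).image (fun z => x + z)) φ' x)) ^ 2 ∂ν|)) ν ∧
      ∫ φ, Real.exp (w R * (R : ℝ) ^ 4 / C₁ *
        |((φ (x + e j) - dirichletField ((sbox (R + 1)).image (fun z => x + z)) φ (x + e j)) -
            (φ x - dirichletField ((sbox (R + 1)).image (fun z => x + z)) φ x)) ^ 2 -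
          ∫ φ', ((φ' (x + e j) - dirichletField ((sbox (R + 1)).image (fun z => x + z)) φ' (x + e j)) -
            (φ' x - dirichletField ((sbox (R + 1)).image (fun z => x + z)) φ' x)) ^ 2 ∂ν|) ∂ν ≤ Real.exp B := by
  classical
  rintro ⟨C₁, B, hC₁, hRM⟩
  have hP := hν.1.isProbabilityMeasure
  obtain ⟨c, hc0, R₀, hc⟩ := gff_integral_centreGradient_sq_ge hν
  set p₀ : ℝ := (gaussianReal 0 1 (Set.Icc (-(1 / 2 : ℝ)) (1 / 2))).toReal with hp₀
  have hp₀0 : 0 < p₀ := gaussianReal_Icc_half_pos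
  -- choose `R ≥ max R₀ 1` with `w R > 0` and `w R · κ > B`, `κ = 3p₀c/(4C₁)`
  set κ : ℝ := 3 / 4 * p₀ * c / C₁ with hκ
  have hκ0 : 0 < κ := by positivity
  obtain ⟨R, hwR, hw0, hRR₀, hR1⟩ := ((hw.eventually_gt_atTop (B / κ)).and ((hw.eventually_gt_atTop 0).and
    ((eventually_ge_atTop R₀).and (eventually_ge_atTop 1)))).exists
  -- the cube at the origin in direction 0
  set j : Fin 4 := 0 with hj
  set x : Site 4 := 0 with hx
  set Λ : Finset (Site 4) := (sbox (R + 1)).image (fun z => x + z) with hΛ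
  set a : (Site 4 → ℝ) → ℝ := fun φ => (φ (x + e j) - dirichletField Λ φ (x + e j)) - (φ x - dirichletField Λ φ x) with ha
  set s : ℝ := ∫ φ, (a φ) ^ 2 ∂ν with hs
  set lam : ℝ := w R * (R : ℝ) ^ 4 / C₁ with hlam
  have hlam0 : 0 ≤ lam := by positivity
  obtain ⟨hint, hle⟩ := hRM R hR1 j x
  have hint' : Integrable (fun φ => Real.exp (lam * |(a φ) ^ 2 - s|)) ν := hint
  have hle' : ∫ φ, Real.exp (lam * |(a φ) ^ 2 - s|) ∂ν ≤ Real.exp B := hle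
  have hmean : c / (R : ℝ) ^ 4 ≤ s := hc R hRR₀ hR1 j x
  -- `a` is a centred Gaussian (a boundary linear statistic)
  set S : Finset (Site 4) := (sbox (R + 2)).image (fun z => x + z) with hS
  have hbdS : outerBoundary (zdGraph 4) Λ ⊆ S := outerBoundary_image_sbox_subset (R + 1) x
  have hxΛ : x ∈ Λ := by have h := add_mem_image_sbox x (zero_mem_sbox (R + 1)); rwa [add_zero] at h
  have hxeΛ : x + e j ∈ Λ := add_mem_image_sbox x (e_mem_sbox (by omega) j)
  have ha_lin : a = fun φ => ∑ w' ∈ S, (Literature.Probability.LatticeModels.poissonKernel Λ (x + e j) w' -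
      Literature.Probability.LatticeModels.poissonKernel Λ x w') * φ w' := by
    funext φ
    simp only [ha]
    rw [sub_dirichletField_eq_sum hbdS φ hxeΛ, sub_dirichletField_eq_sum hbdS φ hxΛ, ← Finset.sum_sub_distrib]
    exact Finset.sum_congr rfl fun w' _ => by ring
  have haG : HasGaussianLaw a ν := by rw [ha_lin]; exact hasGaussianLaw_linStat hν S _
  have ham : Measurable a := by rw [ha_lin]; exact measurable_linStat S _
  have ha0 : ∫ φ, a φ ∂ν = 0 := by rw [ha_lin]; exact integral_linStat hν S _
  have hfluct : 3 / 4 * p₀ * s ≤ ∫ φ, |(a φ) ^ 2 - s| ∂ν := integral_abs_sq_sub_integral_sq_ge haG ham ha0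
  -- Jensen for `exp`
  have hZint : Integrable (fun φ => lam * |(a φ) ^ 2 - s|) ν :=
    ((haG.memLp_two.integrable_sq.sub (integrable_const s)).abs).const_mul lam
  have hJ : Real.exp (∫ φ, lam * |(a φ) ^ 2 - s| ∂ν) ≤ ∫ φ, Real.exp (lam * |(a φ) ^ 2 - s|) ∂ν :=
    ConvexOn.map_integral_le convexOn_exp Real.continuous_exp.continuousOn isClosed_univ
      (Filter.Eventually.of_forall fun _ => Set.mem_univ _) hZint hint'
  have hZB : ∫ φ, lam * |(a φ) ^ 2 - s| ∂ν ≤ B := Real.exp_le_exp.1 (hJ.trans hle')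
  rw [integral_const_mul] at hZB
  -- the lower bound `lam · (3p₀/4) s ≥ w R · κ > B`
  have hRpos : (0 : ℝ) < (R : ℝ) ^ 4 := by positivity
  have h1 : w R * κ ≤ lam * (3 / 4 * p₀ * s) := by
    have hs' : c ≤ s * (R : ℝ) ^ 4 := by rwa [div_le_iff₀ hRpos] at hmean
    calc w R * κ = w R * (R : ℝ) ^ 4 / C₁ * (3 / 4 * p₀ * (c / (R : ℝ) ^ 4)) := by
          rw [hκ]; field_simp
      _ ≤ lam * (3 / 4 * p₀ * s) := by rw [hlam]; gcongr
  have h2 : B < w R * κ := by rwa [div_lt_iff₀ hκ0] at hwR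
  have h3 : lam * (3 / 4 * p₀ * s) ≤ lam * ∫ φ, |(a φ) ^ 2 - s| ∂ν := mul_le_mul_of_nonneg_left hfluct hlam0
  linarith

end Summit.QuantumFields.YangMills.Cruxes.UVSeamRec.GaussianCalibration

end
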